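import Literature.IUT.HodgeTheaters.AutHolSpaceNFEquivariantPush
import HarnessLib

/-!
# [IUTchI] Rmk 3.4.3 (ii) at the genuine model: the `Aut^hol`-equivariant push of `ℂ ∖ {0,1}` (assembly)

S. Mochizuki, *Inter-universal Teichmüller theory I*, §3, Remark 3.4.3 (ii), kurims p. 83
[cite: Mochizuki2012, Rmk 3.4.3 (ii) p.83] [claim: Mochizuki2012, status: disputed].  Continuation of
`AutHolSpaceNFEquivariantPush.lean` (seat abc-iut-L6-t15 gen 4).  For `U = ℂ ∖ {0,1}` we assemble
the six conjugates `g ∘ β ∘ g⁻¹`, `g ∈ S₃ = {z, 1-z, 1/z, 1-1/z, 1/(1-z), 1-1/(1-z)}`, of the point-push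
`β` supported in `B(3, 1/10)` into ONE self-homeomorphism `α` of `U` and prove:

* `AutHolSpaceNFWitness.exists_equivariant_push` — **`α` commutes with every `φ ∈ holAut U`**
  (the six supports lie in the pairwise disjoint discs of radius `1/6` around `3, -2, 1/3, 2/3, -1/2,
  3/2`, so the conjugates commute and `α` is `S₃`-equivariant; `Aut^hol(U) = S₃` by
  `ThricePunctured.eq_one_of_six`) **and moves the NF-point `3` to the non-algebraic point `3 + ξ/10`**,
  `ξ = liouvilleNumber 10`.

This is the witness consumed by `AutHolSpaceNFFunctorialityNegative.lean`.  Proof-only: no definitions.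
-/

noncomputable section

namespace Literature.IUT.HodgeTheaters

namespace AutHolSpaceNFWitness

open _root_.Filter _root_.Topology _root_.Metric _root_.Set _root_.Function
open scoped _root_.Manifold _root_.ContDiff
open _root_.TopologicalSpace (Opens)
open Literature.AnabelianGeometry.AbsoluteAnabelian Literature.Analysis.Calculus
open Literature.Analysis.Complex Literature.Analysis.Complex.ThricePunctured

variable {U : Opens ℂ} (hU : (U : Set ℂ) = {z | z ≠ 0 ∧ z ≠ 1})

/-! ### The six images of the disc `B(3, 1/10)` lie in pairwise disjoint discs of radius `1/6` -/

/-- For `‖y - 3‖ < 1/10`, the six anharmonic images of `y` lie within `1/6` of `3, -2, 1/3, 2/3, -1/2,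
3/2` respectively. [cite: Mochizuki2012, Rmk 3.4.3 (ii) p.83] -/
theorem anharmonic_images_near {y : ℂ} (hy : ‖y - 3‖ < 1/10) :
    ‖y - 3‖ < 1/6 ∧ ‖(1 - y) - (-2)‖ < 1/6 ∧ ‖y⁻¹ - 3⁻¹‖ < 1/6 ∧ ‖(1 - y⁻¹) - (1 - 3⁻¹)‖ < 1/6 ∧
      ‖(1 - y)⁻¹ - (-2)⁻¹‖ < 1/6 ∧ ‖(1 - (1 - y)⁻¹) - (1 - (-2)⁻¹)‖ < 1/6 := by
  have hy3 : (29 : ℝ)/10 ≤ ‖y‖ := by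
    have := norm_sub_norm_le (3 : ℂ) (3 - y)
    rw [sub_sub_cancel, norm_sub_rev] at this
    have h3 : ‖(3 : ℂ)‖ = 3 := by norm_num
    linarith
  have hy1 : (19 : ℝ)/10 ≤ ‖1 - y‖ := by
    have h2 : ‖(1 : ℂ) - 3‖ ≤ ‖(1 : ℂ) - y‖ + ‖y - 3‖ := norm_sub_le_norm_sub_add_norm_sub 1 y 3
    have h13 : ‖(1 : ℂ) - 3‖ = 2 := by norm_num
    linarith
  have hy0 : y ≠ 0 := fun h => by rw [h, norm_zero] at hy3; linarith
  have hy1' : (1 : ℂ) - y ≠ 0 := fun h => by rw [h, norm_zero] at hy1; linarith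
  -- `‖y⁻¹ - 3⁻¹‖ = ‖3 - y‖ / (‖y‖ · 3)` and `‖(1-y)⁻¹ - (-2)⁻¹‖ = ‖y - 3‖ / (‖1 - y‖ · 2)`
  have hinv : ‖y⁻¹ - 3⁻¹‖ < 1/6 := by
    rw [inv_sub_inv hy0 three_ne_zero, norm_div, norm_mul, norm_sub_rev]
    have h3 : ‖(3 : ℂ)‖ = 3 := by norm_num
    rw [h3, div_lt_iff₀ (by positivity)]
    nlinarith
  have hinv' : ‖(1 - y)⁻¹ - (-2)⁻¹‖ < 1/6 := by
    have h2 : (-2 : ℂ) ≠ 0 := by norm_num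
    rw [inv_sub_inv hy1' h2, norm_div, norm_mul]
    have e : (-2 : ℂ) - (1 - y) = y - 3 := by ring
    have hn2 : ‖(-2 : ℂ)‖ = 2 := by norm_num
    rw [e, hn2, div_lt_iff₀ (by positivity)]
    nlinarith
  refine ⟨by linarith, ?_, hinv, ?_, hinv', ?_⟩
  · have e : (1 - y) - (-2 : ℂ) = -(y - 3) := by ring
    rw [e, norm_neg]; linarith
  · have e : (1 - y⁻¹) - (1 - (3 : ℂ)⁻¹) = -(y⁻¹ - 3⁻¹) := by ring
    rw [e, norm_neg]; exact hinv
  · have e : (1 - (1 - y)⁻¹) - (1 - (-2 : ℂ)⁻¹) = -((1 - y)⁻¹ - (-2)⁻¹) := by ring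
    rw [e, norm_neg]; exact hinv'

/-- The six discs of radius `1/6` around `3, -2, 1/3, 2/3, -1/2, 3/2` are pairwise disjoint: a point in
two of them forces two of the centres within `1/3`. [cite: Mochizuki2012, Rmk 3.4.3 (ii) p.83] -/
theorem centres_far {x a b : ℂ} (ha : ‖x - a‖ < 1/6) (hb : ‖x - b‖ < 1/6) : ‖a - b‖ < 1/3 := by
  have := norm_sub_le_norm_sub_add_norm_sub a x b
  rw [norm_sub_rev a x] at this
  linarith

/-! ### The equivariant push -/

include hU in
/-- **The `Aut^hol`-equivariant push of `ℂ ∖ {0,1}`.**  There is a self-homeomorphism `α` of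
`U = ℂ ∖ {0,1}` which COMMUTES WITH EVERY biholomorphic automorphism `φ ∈ holAut U` ([AbsTopIII]
Def. 2.1 (i)) and moves the NF-point `3` to `3 + ξ/10`, `ξ = liouvilleNumber 10` (a non-algebraic point,
`not_isAlgebraic_push_value`).  Construction: the product of the six conjugates `g ∘ β_U ∘ g⁻¹` of the
restricted point-push `β_U`, `g` running over the anharmonic group generated by `z ↦ 1-z`, `z ↦ 1/z`;
the conjugates have pairwise disjoint supports, hence `α` is `S₃`-equivariant, and
`Aut^hol(U) = S₃` (`eq_one_of_six`). [cite: Mochizuki2012, Rmk 3.4.3 (ii) p.83] -/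
theorem exists_equivariant_push :
    ∃ α : U ≃ₜ U, (∀ φ : U ≃ₜ U, φ ∈ holAut U → α * φ = φ * α) ∧
      ∃ x : U, (x : ℂ) = 3 ∧ (α x : ℂ) = 3 + ((liouvilleNumber 10 / 10 : ℝ) : ℂ) := by
  classical
  -- generators, relations, coordinates
  obtain ⟨σ, hσ, hσx⟩ := exists_oneSub_mem_holAut hU
  obtain ⟨τ, hτ, hτx⟩ := exists_inv_mem_holAut hU
  have hne0 : ∀ x : U, (x : ℂ) ≠ 0 := fun x => ((mem_iff hU).mp x.2).1
  have hne1 : ∀ x : U, (1 : ℂ) - x ≠ 0 := fun x => sub_ne_zero.mpr (Ne.symm ((mem_iff hU).mp x.2).2)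
  have hσσ : σ * σ = 1 := by
    ext x; change ((σ (σ x) : U) : ℂ) = x; rw [hσx, hσx]; ring
  have hττ : τ * τ = 1 := by
    ext x; change ((τ (τ x) : U) : ℂ) = x; rw [hτx, hτx, inv_inv]
  have hτστ : τ * σ * τ = σ * τ * σ := by
    ext x
    change ((τ (σ (τ x)) : U) : ℂ) = ((σ (τ (σ x)) : U) : ℂ)
    rw [hτx, hσx, hτx, hσx, hτx, hσx]
    have h0 := hne0 x; have h1 := hne1 x
    have h1' : (x : ℂ) - 1 ≠ 0 := fun h => h1 (by linear_combination -h)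
    field_simp
    ring
  -- the point-push and its restriction
  obtain ⟨β, hfix, hin, hβ3⟩ := exists_push
  obtain ⟨βU, hβU⟩ := exists_restrict hU hfix hin
  -- `βU` fixes points outside the disc and preserves the disc
  set B : Set ℂ := ball (3 : ℂ) (1/10) with hB
  have hβUfix : ∀ y : U, (y : ℂ) ∉ B → βU y = y := fun y hy =>
    Subtype.ext (by rw [hβU]; exact (hfix _ hy).1)
  have hβUin : ∀ y : U, (y : ℂ) ∈ B → (βU y : ℂ) ∈ B := fun y hy => by
    rw [hβU]; exact (hin _ hy).1
  -- the six words `g i`, their coordinates at the centre `3`, and the six disc centres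
  let g : Fin 6 → (U ≃ₜ U) := ![1, σ, τ, σ * τ, τ * σ, σ * τ * σ]
  let p : Fin 6 → ℂ := ![3, -2, 3⁻¹, 1 - 3⁻¹, (-2)⁻¹, 1 - (-2)⁻¹]
  -- coordinates of `g i y` and nearness to `p i` when `y ∈ B`
  have hnear : ∀ i (y : U), (y : ℂ) ∈ B → ‖((g i y : U) : ℂ) - p i‖ < 1/6 := by
    intro i y hy
    rw [hB, mem_ball, dist_eq_norm] at hy
    obtain ⟨h0, h1, h2, h3, h4, h5⟩ := anharmonic_images_near hy
    fin_cases i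
    · simpa [g, p] using h0
    · simpa [g, p, Homeomorph.mul_apply, hσx] using h1
    · simpa [g, p, Homeomorph.mul_apply, hτx] using h2
    · simpa [g, p, Homeomorph.mul_apply, hσx, hτx] using h3
    · simpa [g, p, Homeomorph.mul_apply, hσx, hτx] using h4
    · simpa [g, p, Homeomorph.mul_apply, hσx, hτx] using h5
  have hpfar : ∀ i j, i ≠ j → (1:ℝ)/3 ≤ ‖p i - p j‖ := by
    intro i j hij
    fin_cases i <;> fin_cases j <;> first | exact absurd rfl hij | (simp only [p]; norm_num)
  -- conjugates and supports
  let c : Fin 6 → (U ≃ₜ U) := fun i => g i * βU * (g i)⁻¹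
  let S : Fin 6 → Set U := fun i => {x | (((g i)⁻¹ x : U) : ℂ) ∈ B}
  have hcapp : ∀ i x, c i x = g i (βU ((g i)⁻¹ x)) := fun i x => rfl
  have hginv : ∀ i x, g i ((g i)⁻¹ x) = x := fun i x => by
    rw [← Homeomorph.mul_apply, mul_inv_cancel]; rfl
  have hginv' : ∀ i x, (g i)⁻¹ (g i x) = x := fun i x => by
    rw [← Homeomorph.mul_apply, inv_mul_cancel]; rfl
  have hfixc : ∀ i x, x ∉ S i → c i x = x := fun i x hx => by
    rw [hcapp, hβUfix _ hx, hginv]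
  have hstabc : ∀ i x, x ∈ S i → c i x ∈ S i := fun i x hx => by
    change (((g i)⁻¹ (c i x) : U) : ℂ) ∈ B
    rw [hcapp, hginv']
    exact hβUin _ hx
  have hSsub : ∀ i x, x ∈ S i → ‖(x : ℂ) - p i‖ < 1/6 := fun i x hx => by
    have := hnear i ((g i)⁻¹ x) hx
    rwa [hginv] at this
  have hdisj : ∀ i j, i ≠ j → Disjoint (S i) (S j) := fun i j hij =>
    Set.disjoint_left.mpr fun x hxi hxj => by
      have := centres_far (hSsub i x hxi) (hSsub j x hxj)
      linarith [hpfar i j hij]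
  -- the product `α`
  let L : List (Fin 6) := List.finRange 6
  have hL : L.Nodup := List.nodup_finRange 6
  have hmemL : ∀ i, i ∈ L := fun i => List.mem_finRange i
  let α : U ≃ₜ U := (L.map c).prod
  have key := list_prod_apply c S hfixc hstabc hdisj L hL
  have hαS : ∀ i x, x ∈ S i → α x = c i x := fun i x hx => (key x).1 i (hmemL i) hx
  have hα0 : ∀ x, (∀ i, x ∉ S i) → α x = x := fun x hx => (key x).2 fun i _ => hx i
  -- equivariance under a generator `h` permuting the words: `h * g i = g (π i)`
  have equiv : ∀ (h : U ≃ₜ U) (π : Fin 6 → Fin 6), (∀ i, h * g i = g (π i)) →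
      Function.Injective π → h * α = α * h := by
    intro h π hπ hπi
    have hS : ∀ i x, x ∈ S i ↔ h x ∈ S (π i) := fun i x => by
      change (((g i)⁻¹ x : U) : ℂ) ∈ B ↔ (((g (π i))⁻¹ (h x) : U) : ℂ) ∈ B
      rw [← hπ i, mul_inv_rev, Homeomorph.mul_apply, ← Homeomorph.mul_apply h⁻¹ h,
        inv_mul_cancel]
      rfl
    ext x
    change ((h (α x) : U) : ℂ) = ((α (h x) : U) : ℂ)
    congr 1
    by_cases hx : ∃ i, x ∈ S i
    · obtain ⟨i, hi⟩ := hx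
      rw [hαS i x hi, hαS (π i) (h x) ((hS i x).mp hi), hcapp, hcapp, ← hπ i, mul_inv_rev,
        Homeomorph.mul_apply, Homeomorph.mul_apply, ← Homeomorph.mul_apply h⁻¹ h, inv_mul_cancel]
      rfl
    · push Not at hx
      have hx' : ∀ j, h x ∉ S j := by
        intro j hj
        -- `π` is a bijection of `Fin 6`; pull back along it
        obtain ⟨i, rfl⟩ := (Finite.injective_iff_surjective.mp hπi) j
        exact hx i ((hS i x).mpr hj)
      rw [hα0 x hx, hα0 (h x) hx']
  -- the two generators permute the words
  have hσeq : σ * α = α * σ := by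
    refine equiv σ ![1, 0, 3, 2, 5, 4] (fun i => ?_) (by decide)
    fin_cases i
    · change σ * 1 = σ; rw [mul_one]
    · change σ * σ = 1; exact hσσ
    · rfl
    · change σ * (σ * τ) = τ; rw [← mul_assoc, hσσ, one_mul]
    · rfl
    · change σ * (σ * τ * σ) = τ * σ; rw [← mul_assoc, ← mul_assoc, hσσ, one_mul]
  have hτeq : τ * α = α * τ := by
    refine equiv τ ![2, 4, 0, 5, 1, 3] (fun i => ?_) (by decide)
    fin_cases i
    · change τ * 1 = τ; rw [mul_one]
    · rfl
    · change τ * τ = 1; exact hττ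
    · change τ * (σ * τ) = σ * τ * σ; rw [← mul_assoc, hτστ]
    · change τ * (τ * σ) = σ; rw [← mul_assoc, hττ, one_mul]
    · change τ * (σ * τ * σ) = σ * τ
      rw [← mul_assoc, ← mul_assoc, hτστ, mul_assoc, hσσ, mul_one]
  -- hence `α` commutes with all six words, i.e. with all of `holAut U`
  refine ⟨α, fun φ hφ => ?_, ⟨3, (mem_iff hU).mpr ⟨three_ne_zero, by norm_num⟩⟩, rfl, ?_⟩
  · -- identify `φ` with a word
    have hφeq : ∀ (w : U ≃ₜ U), (∀ x : U, ((φ x : U) : ℂ) = ((w x : U) : ℂ)) → φ = w :=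
      fun w h => Homeomorph.ext fun x => Subtype.ext (h x)
    have comm1 : α * σ = σ * α := hσeq.symm
    have comm2 : α * τ = τ * α := hτeq.symm
    have hcomm : ∀ w₁ w₂ : U ≃ₜ U, α * w₁ = w₁ * α → α * w₂ = w₂ * α →
        α * (w₁ * w₂) = w₁ * w₂ * α := fun w₁ w₂ h₁ h₂ => by
      rw [← mul_assoc, h₁, mul_assoc, h₂, ← mul_assoc]
    rcases eq_one_of_six hU hφ with h | h | h | h | h | h
    · rw [hφeq 1 fun x => by rw [h x]; rfl, mul_one, one_mul]
    · rw [hφeq σ fun x => by rw [h x, hσx]]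
      exact comm1
    · rw [hφeq τ fun x => by rw [h x, hτx]]
      exact comm2
    · rw [hφeq (τ * σ) fun x => by rw [h x, Homeomorph.mul_apply, hτx, hσx]]
      exact hcomm τ σ comm2 comm1
    · rw [hφeq (σ * τ) fun x => by rw [h x, Homeomorph.mul_apply, hσx, hτx]]
      exact hcomm σ τ comm1 comm2
    · rw [hφeq (σ * (τ * σ)) fun x => by
        rw [h x, Homeomorph.mul_apply, Homeomorph.mul_apply, hσx, hτx, hσx]]
      exact hcomm σ (τ * σ) comm1 (hcomm τ σ comm2 comm1)
  · -- the centre `3` lies in the support `S 0` and is moved by `βU`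
    set x₃ : U := ⟨3, (mem_iff hU).mpr ⟨three_ne_zero, by norm_num⟩⟩
    have hx3 : x₃ ∈ S 0 := by
      change ((((g 0)⁻¹ x₃ : U)) : ℂ) ∈ B
      have : g 0 = 1 := rfl
      rw [this, inv_one]
      change (3 : ℂ) ∈ B
      exact mem_ball_self (by norm_num)
    rw [hαS 0 x₃ hx3, hcapp]
    have : g 0 = 1 := rfl
    rw [this, inv_one]
    change ((βU x₃ : U) : ℂ) = _
    rw [hβU]
    exact hβ3

end AutHolSpaceNFWitness

end Literature.IUT.HodgeTheaters

end
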